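import Literature.Probability.RandomPlanarGeometry.HexSAWBridgeLogDecay
import Literature.Probability.RandomPlanarGeometry.HexSAWStripBlimPos
import Literature.Probability.RandomPlanarGeometry.HexSAWStripWidthOne
import HarnessLib

/-!
# Critical strip bridges in the Duminil-Copin–Smirnov frame: the closed-form harmonic bounds `B_T ≥ (2√2 − 2)/T` and (Riccati form)
# `B_T ≥ 2/(√2·T + 1)`, the ratio law `B_{T+1}/B_T → 1` with an explicit rate, and the TWO-SIDED height-locality rate of the arch class

Topic `Literature/Probability/RandomPlanarGeometry` (lane «pcv-sawmu», a-idea-1 gen 24, door «PAR-BRIDGE-RATIO»; continues the tree's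
`HexSAWStripIdentity.lean` (`HV.strip_identity_lim : c_α A_T + B_T = 1`, `HV.stripBlim_eq_escape`, `HV.stripBlim_ge_div : min(B_1, x_c/c_α)/(T+1)
≤ B_{T+1}`, `HV.tendsto_sum_stripBlim_atTop`, `HV.tendsto_stripAlim`), `HexSAWEscapeMass.lean` (`HV.escape_le_succ`: the Duminil-Copin–Smirnov
recursion in escape-mass form), `HexSAWBridgeLogDecay.lean` (`hexBridgeLogDecay : B_T ≤ 5 (ln T)^{−1/3}`, `T ≥ 2`) `HexSAWStripWidthOne.lean`
(`HV.stripBlim_one_eq : B_1 = 2√2 − 2`) and `HexSAWStripBlimPos.lean` (`HV.stripBlim_pos`).  Here `A_T = HV.stripAlim T`, `B_T = HV.stripBlim T` are the critical arch / bridge generating functions of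
the strip `S_T` of Duminil-Copin–Smirnov (§3), `c_α = cos(3π/8)`, `x_c = 1/√(2+√2)`.

What this file adds (all short consequences of the tree theorems above; nothing here is claimed to be in print as stated):

* `cos_three_pi_div_eight_mul_inv_hexCriticalFugacity` — the recursion constant of the tree's escape-mass form is `κ := c_α/x_c = √2/2`, and
  `dcs_min_eq` — Duminil-Copin–Smirnov's constant EVALUATES: `min(B_1, κ⁻¹) = min(2√2 − 2, √2) = 2√2 − 2`; hence the closed form
  **`(2√2 − 2)/T ≤ B_T(x_c)`** for every `T ≥ 1` (`stripBlim_ge_closed`, `stripBlim_succ_ge_closed`; `2√2 − 2 = 0.828…`).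
* the RECIPROCAL (Riccati) form of the recursion, `1/B_{T+1} − 1/B_T ≤ κ = √2/2` (`inv_stripBlim_succ_sub_inv_le`), hence by induction from
  `1/B_1 = (√2+1)/2` the bound `1/B_T ≤ (√2 T + 1)/2` (`inv_stripBlim_le`) and **`2/(√2·T + 1) ≤ B_T(x_c)`** (`stripBlim_ge_riccati`): asymptotic
  constant `1/κ = √2 = 1.414…` instead of `2√2 − 2 = 0.828…`, equality at `T = 1` (`two_div_sqrt_two_add_one_eq_stripBlim_one`), and it dominates
  the evaluated Duminil-Copin–Smirnov bound for every `T ≥ 1` (`dcs_closed_le_riccati`); on the arch side `2/(c_α(√2 T + 1)) ≤ 1/c_α − A_T`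
  (`stripAlim_deficit_ge_riccati`), numerically `7/(2(T+1)) ≤ 1/c_α − A_T` (`seven_div_two_mul_succ_le_stripAlim_deficit`, `c_α ≤ 2/5`).
* the recursion in bridge form `B_T ≤ B_{T+1} + (√2/2) B_{T+1}²` (`stripBlim_le_succ_add_mul_sq`) and the RATIO LAW it implies:
  `B_{T+1}/B_T ∈ [1 − (√2/2) B_{T+1}, 1]` (`ratio_stripBlim_mem_Icc`), **`B_{T+2}/B_{T+1} → 1`** (`tendsto_ratio_stripBlim`: the critical strip
  bridges have NO geometric decay rate in the width), with the explicit rate `|1 − B_{T+1}/B_T| ≤ (5√2/2)(ln(T+1))^{−1/3} ≤ 4 (ln(T+1))^{−1/3}`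
  (`abs_one_sub_ratio_stripBlim_le_log`, `abs_one_sub_ratio_stripBlim_le_four_mul_log`); `¬ Summable B` (`not_summable_stripBlim_succ`).
* HEIGHT LOCALITY OF THE ARCH CLASS WITH A TWO-SIDED EXPLICIT RATE: `1/c_α − A_T = B_T/c_α` EXACTLY (`inv_cos_sub_stripAlim_eq`, the lateral class
  vanishing in the limit, tree `HV.stripElim_zero`), so **`2/T ≤ 1/c_α − A_T ≤ 14 (ln T)^{−1/3}`** (`two_div_le_stripAlim_deficit` for `T ≥ 1`,
  `stripAlim_deficit_le_fourteen_mul_log` for `T ≥ 2`, `stripAlim_deficit_mem_Icc`; exact constants `(2√2−2)/c_α = 2.16…` and `5/c_α = 13.06…`),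
  the deficits are not summable (`not_summable_stripAlim_deficit`) and their ratio tends to `1` (`tendsto_ratio_stripAlim_deficit`).

Honest label (author's expectation): LANE COROLLARY / CONSOLIDATION (XS–S).  The recursion and `B_T ≥ min[B_1, 1/(c_α x_c)]/T` are Duminil-Copin–
Smirnov's (§3, proof of Theorem 1; printed with the factor `x_c`, the tree's kernel form `HV.escape_le_succ` carries `x_c⁻¹`, whence `κ = √2/2`
here — the evaluated minimum is `B_1 = 2√2 − 2` in either form); `B_T → 0` with the `(ln T)^{−1/3}` rate is Glazman–Manolescu's Proposition 1.1
(in print along a subsequence; the all-`T` form with the constant `5` is the TREE's `hexBridgeLogDecay`); `A_T → 1/c_α` is the tree's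
`HV.tendsto_stripAlim`.  The closed-form constants (both the evaluated `2√2 − 2` and the Riccati `√2`, the latter by the standard reciprocal step applied to the printed
recursion), the ratio law and the two-sided arch rate are lane statements; the true order of `B_T` is open (print EXPECTS `T^{−1/4}`: Duminil-Copin–Smirnov
2012, Remark 2; Krachun–Panagiotis 2026, §1).

Sources: H. Duminil-Copin, S. Smirnov, *The connective constant of the honeycomb lattice equals √(2+√2)*, Ann. Math. 175 (2012) 1653–1665,
arXiv:1007.0575, §3 (proof of Theorem 1: `1 = c_α A_T + B_T`, `A_{T+1} − A_T ≤ x_c B_{T+1}²`, `B_T ≥ min[B_1, 1/(c_α x_c)]/T`, `Z(x_c) ≥ Σ_T B_T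
= +∞`); A. Glazman, I. Manolescu, *Self-avoiding walk on ℤ² with Yang–Baxter weights: universality of critical fugacity and 2-point
function*, arXiv:1708.00395v3, Proposition 1.1 and Corollary 2.3.
Effectivity (honest slack): the closed-form bound `(2√2 − 2)/T` is not tight at any small `T` (the one-step recursion at `T = 1`
already forces `B_2 ≥ 2 − √2 = 0.585…` against `(2√2 − 2)/2 = 0.414…`), and the `(ln T)^{−1/3}` bounds below, inherited from the
tree's constant-5 `hexBridgeLogDecay`, beat the trivial bounds `|1 − B_{T+1}/B_T| ≤ 1`, `1/c_α − A_T ≤ 1/c_α` only for astronomically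
large `T` (`ln(T+1) > 44`, resp. `ln T > 153`); they are stated for the RATE, never as sharp or numerically useful constants.
-/

noncomputable section

open Finset Filter Topology

namespace Literature.Probability.RandomPlanarGeometry.SAW.HV

/-! ### Constants -/

/-- `√2 ≤ 10/7` and `√2 ≤ 73/49` and `√2 ≤ 3/2` (`√2 = 1.41421…`). [folklore] -/
private theorem sqrt2_le_ten_div_seven : Real.sqrt 2 ≤ 10 / 7 := by
  rw [show (10 / 7 : ℝ) = Real.sqrt ((10 / 7) ^ 2) by rw [Real.sqrt_sq]; norm_num]
  exact Real.sqrt_le_sqrt (by norm_num)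

/-- `1 ≤ √2`. [folklore] -/
private theorem one_le_sqrt2 : 1 ≤ Real.sqrt 2 := by
  rw [show (1 : ℝ) = Real.sqrt 1 by simp]
  exact Real.sqrt_le_sqrt (by norm_num)

/-- `c_α = cos(3π/8) = √(2 − √2)/2`. [cite: DuminilCopinSmirnov2012, §3, Lemma 2 (the weight c_α = cos(3π/8))] -/
theorem cos_three_pi_div_eight_eq_sqrt : Real.cos (3 * Real.pi / 8) = Real.sqrt (2 - Real.sqrt 2) / 2 := by
  rw [show (3 * Real.pi / 8 : ℝ) = Real.pi / 2 - Real.pi / 8 by ring, Real.cos_pi_div_two_sub, Real.sin_pi_div_eight]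

/-- **`κ := c_α · x_c⁻¹ = √2/2`** — the constant of the tree's escape-mass recursion `HV.escape_le_succ` in closed form
(`cos(3π/8) = √(2−√2)/2`, `x_c⁻¹ = √(2+√2)`, `(2−√2)(2+√2) = 2`).
[cite: DuminilCopinSmirnov2012, §1 (x_c = 1/√(2+√2)) and §3 (proof of Theorem 1, the recursion)] -/
theorem cos_three_pi_div_eight_mul_inv_hexCriticalFugacity :
    Real.cos (3 * Real.pi / 8) * hexCriticalFugacity⁻¹ = Real.sqrt 2 / 2 := by
  rw [cos_three_pi_div_eight_eq_sqrt, hexCriticalFugacity, inv_inv]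
  have h2 : (0 : ℝ) ≤ 2 - Real.sqrt 2 := by
    have := sqrt2_le_ten_div_seven; linarith
  have hprod : Real.sqrt (2 - Real.sqrt 2) * Real.sqrt (2 + Real.sqrt 2) = Real.sqrt 2 := by
    rw [← Real.sqrt_mul h2]
    congr 1
    have hs : Real.sqrt 2 ^ 2 = 2 := Real.sq_sqrt (by norm_num)
    nlinarith
  calc Real.sqrt (2 - Real.sqrt 2) / 2 * Real.sqrt (2 + Real.sqrt 2)
        = Real.sqrt (2 - Real.sqrt 2) * Real.sqrt (2 + Real.sqrt 2) / 2 := by ring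
    _ = Real.sqrt 2 / 2 := by rw [hprod]

/-- `5/14 ≤ c_α = cos(3π/8)` (`c_α = 0.3826…`; numeral window for the weight of the parafermionic observable).
[cite: DuminilCopinSmirnov2012, §3, Lemma 2 (the weight c_α = cos(3π/8))] -/
theorem five_div_fourteen_le_cos_three_pi_div_eight : (5 : ℝ) / 14 ≤ Real.cos (3 * Real.pi / 8) := by
  rw [cos_three_pi_div_eight_eq_sqrt]
  have h : (5 : ℝ) / 7 ≤ Real.sqrt (2 - Real.sqrt 2) := by
    rw [show (5 / 7 : ℝ) = Real.sqrt ((5 / 7) ^ 2) by rw [Real.sqrt_sq]; norm_num]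
    exact Real.sqrt_le_sqrt (by have := sqrt2_le_ten_div_seven; nlinarith)
  linarith

/-- `2 c_α ≤ 2√2 − 2` (`0.765… ≤ 0.828…`; equivalently `√(2−√2) ≤ 2√2 − 2`, i.e. `7√2 ≤ 10`): the weight against the width-one bridge value
`B_1 = 2√2 − 2`. [cite: DuminilCopinSmirnov2012, §3, Lemma 2 (the weight c_α = cos(3π/8)) and §3, proof of Theorem 1 (B_1)] -/
theorem two_mul_cos_three_pi_div_eight_le : 2 * Real.cos (3 * Real.pi / 8) ≤ 2 * Real.sqrt 2 - 2 := by
  rw [cos_three_pi_div_eight_eq_sqrt]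
  have hs := sqrt2_le_ten_div_seven
  have h1 := one_le_sqrt2
  have hs2 : Real.sqrt 2 ^ 2 = 2 := Real.sq_sqrt (by norm_num)
  have h : Real.sqrt (2 - Real.sqrt 2) ≤ 2 * Real.sqrt 2 - 2 := by
    rw [Real.sqrt_le_left (by linarith : (0 : ℝ) ≤ 2 * Real.sqrt 2 - 2)]
    nlinarith [hs2, hs]
  linarith

/-! ### The closed-form harmonic lower bound `B_T ≥ (2√2 − 2)/T` -/

/-- **Duminil-Copin–Smirnov's constant evaluates: `min(B_1, κ⁻¹) = min(2√2 − 2, √2) = 2√2 − 2`** (`B_1 = 2√2 − 2` is the tree's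
`HV.stripBlim_one_eq`; `κ⁻¹ = √2`; in this frame the minimum is always the first branch `B_1`, never `κ⁻¹`). [cite: DuminilCopinSmirnov2012, §3 (proof of Theorem 1: "B_T ≥ min[B_1, 1/(c_α x_c)]/T")] -/
theorem dcs_min_eq :
    min (stripBlim 1) (Real.cos (3 * Real.pi / 8) * hexCriticalFugacity⁻¹)⁻¹ = 2 * Real.sqrt 2 - 2 := by
  rw [stripBlim_one_eq, cos_three_pi_div_eight_mul_inv_hexCriticalFugacity]
  refine min_eq_left ?_
  have hs2 : Real.sqrt 2 ^ 2 = 2 := Real.sq_sqrt (by norm_num)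
  have h1 := one_le_sqrt2
  have hinv : (Real.sqrt 2 / 2)⁻¹ = Real.sqrt 2 := by
    rw [inv_div]
    field_simp
    nlinarith
  rw [hinv]
  nlinarith

/-- **`(2√2 − 2)/(T+1) ≤ B_{T+1}(x_c)`** for every `T` — Duminil-Copin–Smirnov's harmonic lower bound with the constant in closed form.
[cite: DuminilCopinSmirnov2012, §3 (proof of Theorem 1: "B_T ≥ min[B_1, 1/(c_α x_c)]/T")] -/
theorem stripBlim_succ_ge_closed (T : ℕ) : (2 * Real.sqrt 2 - 2) / ((T : ℝ) + 1) ≤ stripBlim (T + 1) := by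
  have h := stripBlim_ge_div T
  rwa [dcs_min_eq] at h

/-- **`(2√2 − 2)/T ≤ B_T(x_c)`** (`T ≥ 1`). [cite: DuminilCopinSmirnov2012, §3 (proof of Theorem 1)] -/
theorem stripBlim_ge_closed {T : ℕ} (hT : 1 ≤ T) : (2 * Real.sqrt 2 - 2) / (T : ℝ) ≤ stripBlim T := by
  obtain ⟨n, rfl⟩ := Nat.exists_eq_add_of_le' hT
  have h := stripBlim_succ_ge_closed n
  push_cast
  exact h

/-! ### The recursion in bridge form and the ratio law -/

/-- **`B_T ≤ B_{T+1} + (√2/2)·B_{T+1}²`** (`T ≥ 1`): Duminil-Copin–Smirnov's recursion "`c_α x_c B_{T+1}² + B_{T+1} ≥ B_T`" in the tree's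
escape-mass form (`HV.escape_le_succ`, constant `κ = c_α/x_c = √2/2`) rewritten with `B_T = 1 − c_α A_T`.
[cite: DuminilCopinSmirnov2012, §3 (proof of Theorem 1: A_{T+1} − A_T ≤ x_c B_{T+1}², hence the recursion)] -/
theorem stripBlim_le_succ_add_mul_sq {T : ℕ} (hT : 1 ≤ T) :
    stripBlim T ≤ stripBlim (T + 1) + Real.sqrt 2 / 2 * stripBlim (T + 1) ^ 2 := by
  have h := escape_le_succ hT
  rw [← stripBlim_eq_escape hT, ← stripBlim_eq_escape (T := T + 1) (by omega),
    cos_three_pi_div_eight_mul_inv_hexCriticalFugacity] at h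
  exact h

/-- **`1 − B_{T+1}/B_T ≤ (√2/2)·B_{T+1}`** (`T ≥ 1`). [cite: DuminilCopinSmirnov2012, §3 (proof of Theorem 1, the recursion)] -/
theorem one_sub_ratio_stripBlim_le {T : ℕ} (hT : 1 ≤ T) :
    1 - stripBlim (T + 1) / stripBlim T ≤ Real.sqrt 2 / 2 * stripBlim (T + 1) := by
  have hB := stripBlim_pos hT
  have hB1 := stripBlim_pos (T := T + 1) (by omega)
  have hrec := stripBlim_le_succ_add_mul_sq hT
  have hmono := stripBlim_succ_le hT
  rw [sub_le_iff_le_add, ← sub_le_iff_le_add', le_div_iff₀ hB]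
  have hs : (0 : ℝ) ≤ Real.sqrt 2 / 2 := by positivity
  have := mul_le_mul_of_nonneg_left hmono (mul_nonneg hs hB1.le)
  nlinarith

/-- **`B_{T+1}/B_T ∈ [1 − (√2/2) B_{T+1}, 1]`** (`T ≥ 1`; the upper end is the tree's `HV.stripBlim_succ_le`).
[cite: DuminilCopinSmirnov2012, §3 (proof of Theorem 1); KrachunPanagiotis2026, Lemma 2.3 (B_{T+1} ≤ B_T)] -/
theorem ratio_stripBlim_mem_Icc {T : ℕ} (hT : 1 ≤ T) :
    stripBlim (T + 1) / stripBlim T ∈ Set.Icc (1 - Real.sqrt 2 / 2 * stripBlim (T + 1)) 1 := by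
  refine ⟨by have := one_sub_ratio_stripBlim_le hT; linarith, ?_⟩
  rw [div_le_one (stripBlim_pos hT)]
  exact stripBlim_succ_le hT

/-- **The ratio law `B_{T+2}/B_{T+1} → 1`**: the critical strip bridge generating functions have no geometric decay rate in the width.
[cite: DuminilCopinSmirnov2012, §3 (proof of Theorem 1, the recursion); GlazmanManolescu2019, Proposition 1.1 (B_T → 0)] -/
theorem tendsto_ratio_stripBlim :
    Tendsto (fun T : ℕ => stripBlim (T + 2) / stripBlim (T + 1)) atTop (𝓝 1) := by
  have hlow : Tendsto (fun T : ℕ => 1 - Real.sqrt 2 / 2 * stripBlim (T + 2)) atTop (𝓝 1) := by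
    have h := ((tendsto_stripBlim.comp (tendsto_add_atTop_nat 2)).const_mul (Real.sqrt 2 / 2)).const_sub 1
    simpa using h
  refine tendsto_of_tendsto_of_tendsto_of_le_of_le hlow tendsto_const_nhds (fun T => ?_) fun T => ?_
  · exact (ratio_stripBlim_mem_Icc (T := T + 1) (by omega)).1
  · exact (ratio_stripBlim_mem_Icc (T := T + 1) (by omega)).2

/-- **`|1 − B_{T+1}/B_T| ≤ (5√2/2)·(ln(T+1))^{−1/3}`** (`T ≥ 1`; the tree's `hexBridgeLogDecay : B_T ≤ 5 (ln T)^{−1/3}` at `T+1 ≥ 2`;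
effective only for astronomically large `T`, `ln(T+1) > 44` — a rate statement, not a numerical one).
[cite: GlazmanManolescu2019, Proposition 1.1 (log rate; all-T form with the constant 5 = tree); DuminilCopinSmirnov2012, §3] -/
theorem abs_one_sub_ratio_stripBlim_le_log {T : ℕ} (hT : 1 ≤ T) :
    |1 - stripBlim (T + 1) / stripBlim T| ≤ 5 * Real.sqrt 2 / 2 * Real.log ((T : ℝ) + 1) ^ (-(1 : ℝ) / 3) := by
  obtain ⟨hlo, hhi⟩ := ratio_stripBlim_mem_Icc hT
  have hGM := hexBridgeLogDecay (T + 1) (by omega)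
  push_cast at hGM
  rw [abs_of_nonneg (by linarith)]
  have hs : (0 : ℝ) ≤ Real.sqrt 2 / 2 := by positivity
  have := mul_le_mul_of_nonneg_left hGM hs
  linarith

/-- **`|1 − B_{T+1}/B_T| ≤ 4·(ln(T+1))^{−1/3}`** (`T ≥ 1`; `5√2/2 = 3.53…`). [cite: GlazmanManolescu2019, Proposition 1.1; DuminilCopinSmirnov2012, §3] -/
theorem abs_one_sub_ratio_stripBlim_le_four_mul_log {T : ℕ} (hT : 1 ≤ T) :
    |1 - stripBlim (T + 1) / stripBlim T| ≤ 4 * Real.log ((T : ℝ) + 1) ^ (-(1 : ℝ) / 3) := by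
  refine (abs_one_sub_ratio_stripBlim_le_log hT).trans (mul_le_mul_of_nonneg_right ?_ ?_)
  · have := sqrt2_le_ten_div_seven; linarith
  · exact Real.rpow_nonneg (Real.log_nonneg (by norm_cast; omega)) _

/-- **`Σ_T B_{T+1}(x_c) = +∞` as non-summability** (the tree's `HV.tendsto_sum_stripBlim_atTop` restated: a summable sequence has convergent
partial sums). [cite: DuminilCopinSmirnov2012, §3 (proof of Theorem 1: "Z(x_c) ≥ Σ_T B_T = +∞")] -/
theorem not_summable_stripBlim_succ : ¬ Summable (fun T : ℕ => stripBlim (T + 1)) := fun hs =>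
  not_tendsto_atTop_of_tendsto_nhds hs.tendsto_sum_tsum_nat tendsto_sum_stripBlim_atTop

/-- `Σ_T B_T(x_c) = +∞` (unshifted). [cite: DuminilCopinSmirnov2012, §3 (proof of Theorem 1)] -/
theorem not_summable_stripBlim : ¬ Summable stripBlim := fun hs =>
  not_summable_stripBlim_succ ((summable_nat_add_iff 1).2 hs)

/-! ### The reciprocal (Riccati) form: `1/B_{T+1} − 1/B_T ≤ √2/2`, hence `B_T ≥ 2/(√2·T + 1)` -/

/-- **`1/B_{T+1} − 1/B_T ≤ κ = √2/2`** (`T ≥ 1`): the recursion `B_T ≤ B_{T+1}(1 + κ B_{T+1})` divided by `B_T B_{T+1} > 0`, using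
`B_{T+1} ≤ B_T`.  This additive reciprocal step is what turns Duminil-Copin–Smirnov's recursion into a harmonic bound with the
constant `1/κ = √2` instead of `min(B_1, 1/κ) = 2√2 − 2`.
[cite: DuminilCopinSmirnov2012, §3 (proof of Theorem 1, the recursion); KrachunPanagiotis2026, Lemma 2.3 (B_{T+1} ≤ B_T)] -/
theorem inv_stripBlim_succ_sub_inv_le {T : ℕ} (hT : 1 ≤ T) :
    (stripBlim (T + 1))⁻¹ - (stripBlim T)⁻¹ ≤ Real.sqrt 2 / 2 := by
  have hB := stripBlim_pos hT
  have hB1 := stripBlim_pos (T := T + 1) (by omega)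
  have hrec := stripBlim_le_succ_add_mul_sq hT
  have hmono := stripBlim_succ_le hT
  have hs : (0 : ℝ) ≤ Real.sqrt 2 / 2 := by positivity
  have hkey : stripBlim T - stripBlim (T + 1) ≤ Real.sqrt 2 / 2 * (stripBlim (T + 1) * stripBlim T) := by
    have := mul_le_mul_of_nonneg_left hmono (mul_nonneg hs hB1.le)
    nlinarith
  rw [inv_eq_one_div, inv_eq_one_div, div_sub_div _ _ hB1.ne' hB.ne', one_mul, mul_one, div_le_iff₀ (mul_pos hB1 hB)]
  exact hkey

/-- `1/B_1 = (√2 + 1)/2` (`B_1 = 2√2 − 2` is the tree's `HV.stripBlim_one_eq`). [cite: DuminilCopinSmirnov2012, §3 (proof of Theorem 1, B_1)] -/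
theorem inv_stripBlim_one_eq : (stripBlim 1)⁻¹ = (Real.sqrt 2 + 1) / 2 := by
  rw [stripBlim_one_eq]
  have hs2 : Real.sqrt 2 ^ 2 = 2 := Real.sq_sqrt (by norm_num)
  exact inv_eq_of_mul_eq_one_right (by linear_combination hs2)

/-- **`1/B_T ≤ (√2·T + 1)/2`** (`T ≥ 1`): induction from `1/B_1 = (√2 + 1)/2` with steps `≤ √2/2`.
[cite: DuminilCopinSmirnov2012, §3 (proof of Theorem 1, the recursion)] -/
theorem inv_stripBlim_le {T : ℕ} (hT : 1 ≤ T) : (stripBlim T)⁻¹ ≤ (Real.sqrt 2 * T + 1) / 2 := by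
  induction T, hT using Nat.le_induction with
  | base => rw [inv_stripBlim_one_eq]; norm_num
  | succ n hn ih =>
    have h := inv_stripBlim_succ_sub_inv_le hn
    push_cast
    linarith

/-- **Riccati bound `2/(√2·T + 1) ≤ B_T(x_c)`** (`T ≥ 1`): harmonic lower bound with the asymptotic constant `1/κ = √2 = 1.414…`
(against `2√2 − 2 = 0.828…` in the evaluated Duminil-Copin–Smirnov form `stripBlim_ge_closed`), with equality at `T = 1`.
A lane statement with explicit constants, never "sharp": the true order of `B_T(x_c)` is open (print expects `T^{−1/4}`: DCS12 Remark 2, KP26 §1).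
[cite: DuminilCopinSmirnov2012, §3 (proof of Theorem 1: the recursion and "B_T ≥ min[B_1, 1/(c_α x_c)]/T")] -/
theorem stripBlim_ge_riccati {T : ℕ} (hT : 1 ≤ T) : 2 / (Real.sqrt 2 * T + 1) ≤ stripBlim T := by
  have hB := stripBlim_pos hT
  have h := inv_stripBlim_le hT
  have hq : (0 : ℝ) < Real.sqrt 2 * T + 1 := by positivity
  rw [div_le_iff₀ hq]
  have h1 : 1 ≤ (Real.sqrt 2 * T + 1) / 2 * stripBlim T := by
    have := mul_le_mul_of_nonneg_right h hB.le
    rwa [inv_mul_cancel₀ hB.ne'] at this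
  linarith

/-- The Riccati bound is attained at `T = 1`: `2/(√2 + 1) = 2√2 − 2 = B_1`. [cite: DuminilCopinSmirnov2012, §3 (proof of Theorem 1, B_1)] -/
theorem two_div_sqrt_two_add_one_eq_stripBlim_one : 2 / (Real.sqrt 2 * 1 + 1) = stripBlim 1 := by
  rw [stripBlim_one_eq, mul_one, div_eq_iff (by positivity)]
  have hs2 : Real.sqrt 2 ^ 2 = 2 := Real.sq_sqrt (by norm_num)
  linear_combination (-2 : ℝ) * hs2

/-- The Riccati bound dominates the evaluated Duminil-Copin–Smirnov bound: `(2√2 − 2)/T ≤ 2/(√2·T + 1)` for `T ≥ 1`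
(the difference is `2(√2 − 1)(T − 1)/(T(√2 T + 1)) ≥ 0`). [cite: DuminilCopinSmirnov2012, §3 (proof of Theorem 1)] -/
theorem dcs_closed_le_riccati {T : ℕ} (hT : 1 ≤ T) :
    (2 * Real.sqrt 2 - 2) / (T : ℝ) ≤ 2 / (Real.sqrt 2 * T + 1) := by
  have hT' : (1 : ℝ) ≤ T := by exact_mod_cast hT
  have hs2 : Real.sqrt 2 ^ 2 = 2 := Real.sq_sqrt (by norm_num)
  have h1 := one_le_sqrt2
  have hTpos : (0 : ℝ) < T := by linarith
  have hq : (0 : ℝ) < Real.sqrt 2 * T + 1 := by positivity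
  rw [div_le_iff₀ hTpos, div_mul_eq_mul_div, le_div_iff₀ hq]
  have key : (2 * Real.sqrt 2 - 2) * (Real.sqrt 2 * T + 1) = 2 * T - 2 * (Real.sqrt 2 - 1) * (T - 1) := by
    linear_combination (2 * (T : ℝ)) * hs2
  rw [key]
  nlinarith [mul_nonneg (sub_nonneg.2 h1) (sub_nonneg.2 hT')]

/-- `c_α ≤ 2/5` (`c_α = 0.3826…`; i.e. `√(2 − √2) ≤ 4/5`, i.e. `√2 ≥ 34/25`). [cite: DuminilCopinSmirnov2012, §3, Lemma 2 (the weight c_α = cos(3π/8))] -/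
theorem cos_three_pi_div_eight_le_two_div_five : Real.cos (3 * Real.pi / 8) ≤ 2 / 5 := by
  rw [cos_three_pi_div_eight_eq_sqrt]
  have h34 : (34 : ℝ) / 25 ≤ Real.sqrt 2 := by
    rw [show (34 / 25 : ℝ) = Real.sqrt ((34 / 25) ^ 2) by rw [Real.sqrt_sq]; norm_num]
    exact Real.sqrt_le_sqrt (by norm_num)
  have h : Real.sqrt (2 - Real.sqrt 2) ≤ 4 / 5 := by
    rw [Real.sqrt_le_left (by norm_num : (0 : ℝ) ≤ 4 / 5)]
    linarith
  linarith

/-! ### Height locality of the arch class with a two-sided explicit rate -/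

/-- **`1/c_α − A_T = B_T/c_α` EXACTLY** (`T ≥ 1`): the deficit of the arch generating function below its half-plane value `A_∞ = 1/c_α` is the
bridge term (the lateral class vanishes in the limit, tree `HV.stripElim_zero`, so the identity `c_α A_T + B_T = 1` has no third term).
[cite: GlazmanManolescu2019, Corollary 2.3 (c_α A_T + B_T = 1); DuminilCopinSmirnov2012, §3 (eq. (5))] -/
theorem inv_cos_sub_stripAlim_eq {T : ℕ} (hT : 1 ≤ T) :
    (Real.cos (3 * Real.pi / 8))⁻¹ - stripAlim T = (Real.cos (3 * Real.pi / 8))⁻¹ * stripBlim T := by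
  have hc := cos_three_pi_div_eight_pos
  rw [stripBlim_eq_escape hT, mul_sub, mul_one, ← mul_assoc, inv_mul_cancel₀ hc.ne', one_mul]

/-- `A_T ≤ 1/c_α` (`T ≥ 1`): every strip arch generating function is below its half-plane value. [cite: GlazmanManolescu2019, Corollary 2.3] -/
theorem stripAlim_le_inv_cos {T : ℕ} (hT : 1 ≤ T) : stripAlim T ≤ (Real.cos (3 * Real.pi / 8))⁻¹ := by
  have h := inv_cos_sub_stripAlim_eq hT
  have hB := (stripBlim_pos hT).le
  have hc := inv_pos.2 cos_three_pi_div_eight_pos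
  nlinarith

/-- **Exact two-sided rate: `(2√2−2)/(c_α T) ≤ 1/c_α − A_T ≤ (5/c_α)(ln T)^{−1/3}`** (`T ≥ 2`; constants `2.16…` and `13.06…`).
[cite: DuminilCopinSmirnov2012, §3 (proof of Theorem 1); GlazmanManolescu2019, Proposition 1.1 and Corollary 2.3] -/
theorem stripAlim_deficit_mem_Icc {T : ℕ} (hT : 2 ≤ T) :
    (Real.cos (3 * Real.pi / 8))⁻¹ - stripAlim T ∈
      Set.Icc ((Real.cos (3 * Real.pi / 8))⁻¹ * ((2 * Real.sqrt 2 - 2) / (T : ℝ)))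
        ((Real.cos (3 * Real.pi / 8))⁻¹ * (5 * Real.log T ^ (-(1 : ℝ) / 3))) := by
  rw [inv_cos_sub_stripAlim_eq (by omega)]
  have hc := inv_pos.2 cos_three_pi_div_eight_pos
  exact ⟨mul_le_mul_of_nonneg_left (stripBlim_ge_closed (by omega)) hc.le,
    mul_le_mul_of_nonneg_left (hexBridgeLogDecay T hT) hc.le⟩

/-- **`2/T ≤ 1/c_α − A_T`** (`T ≥ 1`; `(2√2 − 2)/c_α ≥ 2`). [cite: DuminilCopinSmirnov2012, §3 (proof of Theorem 1: B_T ≥ c/T)] -/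
theorem two_div_le_stripAlim_deficit {T : ℕ} (hT : 1 ≤ T) :
    2 / (T : ℝ) ≤ (Real.cos (3 * Real.pi / 8))⁻¹ - stripAlim T := by
  rw [inv_cos_sub_stripAlim_eq hT]
  have hc := cos_three_pi_div_eight_pos
  have hB := stripBlim_ge_closed hT
  have hT' : (0 : ℝ) < T := by exact_mod_cast hT
  have h2c := two_mul_cos_three_pi_div_eight_le
  rw [div_le_iff₀ hT'] at hB ⊢
  calc (2 : ℝ) = (Real.cos (3 * Real.pi / 8))⁻¹ * (2 * Real.cos (3 * Real.pi / 8)) := by field_simp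
    _ ≤ (Real.cos (3 * Real.pi / 8))⁻¹ * (2 * Real.sqrt 2 - 2) := mul_le_mul_of_nonneg_left h2c (inv_pos.2 hc).le
    _ ≤ (Real.cos (3 * Real.pi / 8))⁻¹ * (stripBlim T * T) := mul_le_mul_of_nonneg_left hB (inv_pos.2 hc).le
    _ = (Real.cos (3 * Real.pi / 8))⁻¹ * stripBlim T * T := by ring

/-- **Riccati form of the arch deficit: `2/(c_α(√2·T + 1)) ≤ 1/c_α − A_T`** (`T ≥ 1`; asymptotic constant `√2/c_α = 3.69…` against
`(2√2 − 2)/c_α = 2.16…`). [cite: DuminilCopinSmirnov2012, §3 (proof of Theorem 1); GlazmanManolescu2019, Corollary 2.3] -/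
theorem stripAlim_deficit_ge_riccati {T : ℕ} (hT : 1 ≤ T) :
    2 / (Real.cos (3 * Real.pi / 8) * (Real.sqrt 2 * T + 1)) ≤ (Real.cos (3 * Real.pi / 8))⁻¹ - stripAlim T := by
  rw [inv_cos_sub_stripAlim_eq hT]
  have hc := cos_three_pi_div_eight_pos
  have hB := stripBlim_ge_riccati hT
  calc 2 / (Real.cos (3 * Real.pi / 8) * (Real.sqrt 2 * T + 1))
      = (Real.cos (3 * Real.pi / 8))⁻¹ * (2 / (Real.sqrt 2 * T + 1)) := by
        rw [mul_div_assoc', inv_mul_eq_div, div_div]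
    _ ≤ (Real.cos (3 * Real.pi / 8))⁻¹ * stripBlim T := mul_le_mul_of_nonneg_left hB (inv_pos.2 hc).le

/-- **`7/(2(T+1)) ≤ 1/c_α − A_T`** (`T ≥ 1`): numeral form of the Riccati arch bound (`√2·c_α ≤ 4/7`, `7 c_α ≤ 14/5`); better than
`two_div_le_stripAlim_deficit` from `T = 2` on. [cite: DuminilCopinSmirnov2012, §3 (proof of Theorem 1); GlazmanManolescu2019, Corollary 2.3] -/
theorem seven_div_two_mul_succ_le_stripAlim_deficit {T : ℕ} (hT : 1 ≤ T) :
    7 / (2 * ((T : ℝ) + 1)) ≤ (Real.cos (3 * Real.pi / 8))⁻¹ - stripAlim T := by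
  refine le_trans ?_ (stripAlim_deficit_ge_riccati hT)
  have hc := cos_three_pi_div_eight_pos
  have hc2 := cos_three_pi_div_eight_le_two_div_five
  have hs := sqrt2_le_ten_div_seven
  have hT0 : (0 : ℝ) ≤ T := by positivity
  have hsc : Real.sqrt 2 * Real.cos (3 * Real.pi / 8) ≤ 4 / 7 := by
    have := mul_le_mul hs hc2 hc.le (by norm_num : (0 : ℝ) ≤ 10 / 7)
    linarith
  have hq : (0 : ℝ) < Real.cos (3 * Real.pi / 8) * (Real.sqrt 2 * T + 1) := by positivity
  have h2 : (0 : ℝ) < 2 * ((T : ℝ) + 1) := by positivity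
  rw [div_le_iff₀ h2, div_mul_eq_mul_div, le_div_iff₀ hq]
  nlinarith [mul_le_mul_of_nonneg_right hsc hT0]

/-- **`1/c_α − A_T ≤ 14·(ln T)^{−1/3}`** (`T ≥ 2`; `5/c_α = 13.06…`; beats the trivial `≤ 1/c_α` only for `ln T > 153` — a rate
statement). [cite: GlazmanManolescu2019, Proposition 1.1 and Corollary 2.3] -/
theorem stripAlim_deficit_le_fourteen_mul_log {T : ℕ} (hT : 2 ≤ T) :
    (Real.cos (3 * Real.pi / 8))⁻¹ - stripAlim T ≤ 14 * Real.log T ^ (-(1 : ℝ) / 3) := by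
  refine (stripAlim_deficit_mem_Icc hT).2.trans ?_
  have hc := cos_three_pi_div_eight_pos
  have h514 := five_div_fourteen_le_cos_three_pi_div_eight
  have hL : (0 : ℝ) ≤ Real.log T ^ (-(1 : ℝ) / 3) :=
    Real.rpow_nonneg (Real.log_nonneg (by exact_mod_cast (by omega : 1 ≤ T))) _
  have hk : (Real.cos (3 * Real.pi / 8))⁻¹ * 5 ≤ 14 := by
    rw [inv_mul_le_iff₀ hc]; linarith
  calc (Real.cos (3 * Real.pi / 8))⁻¹ * (5 * Real.log T ^ (-(1 : ℝ) / 3))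
        = (Real.cos (3 * Real.pi / 8))⁻¹ * 5 * Real.log T ^ (-(1 : ℝ) / 3) := by ring
    _ ≤ 14 * Real.log T ^ (-(1 : ℝ) / 3) := mul_le_mul_of_nonneg_right hk hL

/-- **Two-sided numerals: `1/c_α − A_T ∈ [2/T, 14 (ln T)^{−1/3}]`** (`T ≥ 2`).
[cite: DuminilCopinSmirnov2012, §3; GlazmanManolescu2019, Proposition 1.1 and Corollary 2.3] -/
theorem stripAlim_deficit_mem_Icc_numeral {T : ℕ} (hT : 2 ≤ T) :
    (Real.cos (3 * Real.pi / 8))⁻¹ - stripAlim T ∈ Set.Icc (2 / (T : ℝ)) (14 * Real.log T ^ (-(1 : ℝ) / 3)) :=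
  ⟨two_div_le_stripAlim_deficit (by omega), stripAlim_deficit_le_fourteen_mul_log hT⟩

/-- **The arch deficits are not summable**: `Σ_T (1/c_α − A_{T+1}) = +∞`. [cite: DuminilCopinSmirnov2012, §3 (Z(x_c) ≥ Σ B_T = ∞); GlazmanManolescu2019, Corollary 2.3] -/
theorem not_summable_stripAlim_deficit :
    ¬ Summable (fun T : ℕ => (Real.cos (3 * Real.pi / 8))⁻¹ - stripAlim (T + 1)) := by
  have hc := cos_three_pi_div_eight_pos
  have hfun : (fun T : ℕ => (Real.cos (3 * Real.pi / 8))⁻¹ - stripAlim (T + 1)) =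
      fun T : ℕ => (Real.cos (3 * Real.pi / 8))⁻¹ * stripBlim (T + 1) :=
    funext fun T => inv_cos_sub_stripAlim_eq (by omega)
  rw [hfun, summable_mul_left_iff (inv_pos.2 hc).ne']
  exact not_summable_stripBlim_succ

/-- **The arch deficits have no geometric rate: `(1/c_α − A_{T+2})/(1/c_α − A_{T+1}) → 1`**.
[cite: DuminilCopinSmirnov2012, §3 (the recursion); GlazmanManolescu2019, Proposition 1.1 and Corollary 2.3] -/
theorem tendsto_ratio_stripAlim_deficit :
    Tendsto (fun T : ℕ => ((Real.cos (3 * Real.pi / 8))⁻¹ - stripAlim (T + 2)) /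
      ((Real.cos (3 * Real.pi / 8))⁻¹ - stripAlim (T + 1))) atTop (𝓝 1) := by
  have hc : (Real.cos (3 * Real.pi / 8))⁻¹ ≠ 0 := (inv_pos.2 cos_three_pi_div_eight_pos).ne'
  refine tendsto_ratio_stripBlim.congr fun T => ?_
  rw [inv_cos_sub_stripAlim_eq (by omega : 1 ≤ T + 2), inv_cos_sub_stripAlim_eq (by omega : 1 ≤ T + 1),
    mul_div_mul_left _ _ hc]

/-- **One step at most `(1 + √2/2·B_{T+1})`-shrinks the arch deficit**: `(1/c_α − A_T) ≤ (1 + √2/2)·(1/c_α − A_{T+1})` (`T ≥ 1`; `B_{T+1} ≤ 1`).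
[cite: DuminilCopinSmirnov2012, §3 (the recursion); GlazmanManolescu2019, §1 (B_T ≤ 1)] -/
theorem stripAlim_deficit_le_mul_succ {T : ℕ} (hT : 1 ≤ T) :
    (Real.cos (3 * Real.pi / 8))⁻¹ - stripAlim T ≤
      (1 + Real.sqrt 2 / 2) * ((Real.cos (3 * Real.pi / 8))⁻¹ - stripAlim (T + 1)) := by
  rw [inv_cos_sub_stripAlim_eq hT, inv_cos_sub_stripAlim_eq (T := T + 1) (by omega)]
  have hc := inv_pos.2 cos_three_pi_div_eight_pos
  have hrec := stripBlim_le_succ_add_mul_sq hT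
  have hB1 := stripBlim_pos (T := T + 1) (by omega)
  have hle1 := stripBlim_le_one (T := T + 1) (by omega)
  have hs : (0 : ℝ) ≤ Real.sqrt 2 / 2 := by positivity
  have hsq : stripBlim (T + 1) ^ 2 ≤ stripBlim (T + 1) := by nlinarith
  have h1 : stripBlim T ≤ (1 + Real.sqrt 2 / 2) * stripBlim (T + 1) := by nlinarith [mul_le_mul_of_nonneg_left hsq hs]
  calc (Real.cos (3 * Real.pi / 8))⁻¹ * stripBlim T
        ≤ (Real.cos (3 * Real.pi / 8))⁻¹ * ((1 + Real.sqrt 2 / 2) * stripBlim (T + 1)) := mul_le_mul_of_nonneg_left h1 hc.le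
    _ = (1 + Real.sqrt 2 / 2) * ((Real.cos (3 * Real.pi / 8))⁻¹ * stripBlim (T + 1)) := by ring

end Literature.Probability.RandomPlanarGeometry.SAW.HV
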